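import Summits.QuantumFields.BalabanUV.T4Continuum.Support.NE7QbarTangentCritical
import Summits.QuantumFields.BalabanUV.T4Continuum.Support.NE7BalabanGaugeTransport
import Summits.QuantumFields.BalabanUV.T4Continuum.Support.NE3FrameFreeSliceW
import Summits.QuantumFields.BalabanUV.T4Continuum.Support.NE3FrameFreeDecompositionLinear
import HarnessLib

/-!
# NE7MeanZeroGaugeSliceW — THE MEAN-ZERO GAUGE SPACE `Ξ_Q(W)` (nested transported block means zero, corner values FREE), ITS RIESZ PROJECTION STEP, AND THE
# ENERGY BLOCK-LANDAU SLICE `𝒯_E(W)` = {double-bar kernel} ∩ {`hsR`-orthogonal to `gaugeDir W (Ξ_Q(W))`}: decomposition, min-norm, transversality, criticality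

Cell `pub-balaban`, rung (B)+1 sub-cell t4, lineage `b2b-balaban-t4-ne7-p1` (CRUX PROVER NE7 #1 = OWNER of row NE7), generation 99; memo
`t4/b2b-balaban-t4-ne7-p1-g99/ROAD-G99.md` §3.1 ∕ §3.6 (the Bałaban-slice road; this is the slice `𝒯_E(W)` there).

WHY.  Row NE3's slice `T_♮(W) = frameFreeBlockLandauW` quotients the CORNER-TRIVIAL mean-zero generators `Ξ₀₀(W)` (`NE3FrameFreeSliceW.cornerGaugeSpaceW`); gen 99's
numerics (memo §1) show that the corner pinning forces CORNER DIPS of height `≍ M·sup` into the `T_♮`-corrector of a generic representative, incompatible with the ENDs' sup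
currency.  Bałaban's own constraint∕gauge ([B5] `N(Q_k)`, (1.26)) pins no corners: the gauge generators are the MEAN-ZERO fields `Ξ_Q(W)` (corner values free).  THIS FILE types
`Ξ_Q(W)`, proves the zero-propagation that replaces the corner condition (`gaugeDir W ξ = 0 ∧ bmeanIterW ξ = 0 ⟹ ξ = 0`: a covariantly constant generator equals its own transported
block mean at the corners — the curved (‡) `NE3CovariantBlockMean.framePotW_gaugeDir` read at `gaugeDir W ξ = 0`), hence the NONDEGENERACY of the Gram form of `gaugeDir W` on
`Ξ_Q(W)` and the RIESZ PROJECTION STEP with corners free; then the ENERGY BLOCK-LANDAU SLICE `𝒯_E(W)` (skew, periodic, `QbarIter = 0`, `hsR`-orthogonal to `gaugeDir W (Ξ_Q(W))`):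
(E_Q) every skew periodic direction in the double-bar kernel is `Y_E + gaugeDir W η` with `Y_E ∈ 𝒯_E(W)`, `η ∈ Ξ_Q(W)` (the double-bar kernel is stable under `gaugeDir W (Ξ_Q)` by
`NE7BalabanGaugeTransport.QbarIter_gaugeDir_eq_bmean`); Pythagoras∕min-norm; TRANSVERSALITY (`𝒯_E(W) ∩ gaugeDir W(Ξ_Q(W)) = {0}`); and CRITICALITY of a tangent-critical background along
`𝒯_E(W)` (gen 99's `NE7QbarTangentCritical.dAction_eq_zero_of_QbarIter_eq_zero`).
WHAT ([folklore]; 2 DATA defs (`meanZeroGaugeSpaceW`, `energyBlockLandauW`), no `def … : Prop`; 0 sorry).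
§1 `periodicGaugeSpace P` (skew `P`-periodic site fields; finite-dimensional), `meanZeroGaugeSpaceW L k W P = Ξ_Q(W)`; §2 `eq_zero_of_gaugeDir_eq_zero_of_bmeanIterW`;
§3 `gramQ`, `gramQ_nondegenerate`, **`exists_orthogonalQ`**; §4 **`energyBlockLandauW L N k W`** = `𝒯_E(W)`, `sum_nhsNormSq_add_gaugeDir_eq_of_mem` (Pythagoras),
**`exists_decomposition_of_QbarIter_eq_zero`** (E_Q), **`eq_zero_of_mem_of_eq_gaugeDir`** (transversality), **`dAction_eq_zero_of_mem`** (criticality).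
HONEST FRAMING (page 1): finite-dimensional linear algebra and exact kinematics at a fixed background; nothing of Bałaban's asserted; the slice's Poincaré inequality
([B5] (1.90) ∕ [B9] Thm 3.11, tree) is NOT docked here; NE7 NOT PROVED; spine 0∕9; finite T⁴ rung (B)+1 — NOT infinite volume, NOT mass gap, NOT `BetaPertH`, NOT Clay.  Continuum YM
on T⁴ ⇐ BetaPertH ∧ nine spine estimates (0/9 proved); BetaPertH ⇐ (D1) ∧ (D4) ∧ CAP+tail; G-an2-4 gates asym, D1 and NE2/3/4.  Text locations only: [Balaban1984PropagatorsI] (1.18)–(1.26)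
pp. 20–22, (1.69) p. 29; [Balaban1985Averaging] (110)–(120) pp. 31–35.
-/

set_option autoImplicit false

namespace Summit.QuantumFields.BalabanUV.T4Continuum.NE7MeanZeroGaugeSliceW

open scoped BigOperators Matrix.Norms.L2Operator
open Literature.MathematicalPhysics.QuantumFieldTheory.Balaban1983to89
open B7Prop1Explicit B7Prop2Explicit MatrixNorms
open T4AveragingDeficitWall (IsUnitaryCfg IsSkewDir SmallField Plaq)
open T4AveragingDeficitWallBoundary (IsPeriodicCfg periodBox)
open AveragingDeficitPeriodicCounting (IsPeriodicDir)
open AveragingDeficitMultiLevelPrep (cavgIter LevelSmall tower TangentIter)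
open BlockAveragePushDirGauge (gaugeDir isPeriodicDir_gaugeDir)
open NE3TangentCovariantTower (QbarIter framePotW)
open NE3CovariantBlockMean (bmeanIterW framePotW_gaugeDir)
open NE3CovariantCalculus (hsR hsR_add_left hsR_add_right hsR_self)
open NE3LandauOrbit (eq_zero_of_nhsNormSq_eq_zero nhsNormSq_add gaugeDir_skew)
open NE3FrameFreeDecompositionPrep (hsR_smul_left hsR_smul_right)
open NE3FrameFreeDecompositionLinear (framePotW_zero_dir)
open NE3FrameFreeSliceW (bmeanIterW_add bmeanIterW_smul bmeanIterW_zero')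
open NE3CurvedCornerGaugeSpace (eq_zero_of_gaugeDir_eq_zero gaugeDir_add_pi gaugeDir_smul_pi)
open PeriodicChoice (apply_wrap_eq wrap_mem_periodBox)
open NE7CornerSpikeTopDictionary (natCast_tower_eq_pow_mul)
open NE7BalabanGaugeTransport (QbarIter_gaugeDir_eq_bmean)
open NE3CovariantLineSumsTower (QbarIter_add)
open NE7QbarTangentCritical (dAction_eq_zero_of_QbarIter_eq_zero gaugeDir_zero_fun')
open NE3HessForm (dAction)

noncomputable section

variable {d : ℕ} {n : Type*} [Fintype n] [DecidableEq n]

/-! ## §1 Periodic skew generators; the mean-zero gauge space `Ξ_Q(W)` -/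

/-- THE SPACE OF SKEW `P`-PERIODIC GAUGE GENERATORS (no corner condition, no mean condition). [folklore] -/
def periodicGaugeSpace (P : ℕ) : Submodule ℝ (Site d → Matrix n n ℂ) where
  carrier := {ξ | (∀ (x : Site d) (κ : Fin d), ξ (x + (P : ℤ) • e κ) = ξ x) ∧ ∀ x : Site d, ξ x ∈ skewAdjoint (Matrix n n ℂ)}
  zero_mem' := ⟨fun _ _ => rfl, fun _ => (skewAdjoint _).zero_mem⟩
  add_mem' := by
    rintro ξ ζ ⟨hξP, hξs⟩ ⟨hζP, hζs⟩
    exact ⟨fun x κ => by simp only [Pi.add_apply, hξP, hζP], fun x => (skewAdjoint _).add_mem (hξs x) (hζs x)⟩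
  smul_mem' := by
    rintro t ξ ⟨hξP, hξs⟩
    exact ⟨fun x κ => by simp only [Pi.smul_apply, hξP], fun x => skewAdjoint.smul_mem t (hξs x)⟩

omit [Fintype n] [DecidableEq n] in
/-- Membership in `periodicGaugeSpace P`, unfolded. [folklore] -/
theorem mem_periodicGaugeSpace_iff {P : ℕ} {ξ : Site d → Matrix n n ℂ} :
    ξ ∈ periodicGaugeSpace (d := d) (n := n) P ↔
      (∀ (x : Site d) (κ : Fin d), ξ (x + (P : ℤ) • e κ) = ξ x) ∧ ∀ x : Site d, ξ x ∈ skewAdjoint (Matrix n n ℂ) :=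
  Iff.rfl

omit [DecidableEq n] in
/-- `periodicGaugeSpace P` is finite-dimensional (`P ≥ 1`): restriction to the period box is injective. [folklore] -/
theorem finiteDimensional_periodicGaugeSpace {P : ℕ} (hP : 1 ≤ P) :
    FiniteDimensional ℝ (periodicGaugeSpace (d := d) (n := n) P) := by
  let res : periodicGaugeSpace (d := d) (n := n) P →ₗ[ℝ] (↥(periodBox (d := d) P) → Matrix n n ℂ) :=
    { toFun := fun ξ x => (ξ : Site d → Matrix n n ℂ) x.1
      map_add' := fun _ _ => rfl
      map_smul' := fun _ _ => rfl }
  refine FiniteDimensional.of_injective res fun ξ ζ h => ?_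
  apply Subtype.ext
  funext x
  have hξ := apply_wrap_eq (mem_periodicGaugeSpace_iff.mp ξ.2).1 x
  have hζ := apply_wrap_eq (mem_periodicGaugeSpace_iff.mp ζ.2).1 x
  rw [← hξ, ← hζ]
  exact congr_fun h ⟨_, wrap_mem_periodBox P hP x⟩

/-- **`Ξ_Q(W)`** (`meanZeroGaugeSpaceW L k W P`): skew `P`-periodic gauge generators whose NESTED TRANSPORTED BLOCK MEAN through the `k`-fold tower at `W` vanishes
(`bmeanIterW L k W ξ = 0`) — corner values FREE.  Bałaban's `N(Q′_k)` ([B5] (1.25): «Q′_kλ = 0») at a curved background; `Ξ₀₀(W) = Ξ_Q(W) ∩ {corner-trivial}`. [folklore] -/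
def meanZeroGaugeSpaceW (L k : ℕ) (W : Site d → Fin d → (Matrix n n ℂ)ˣ) (P : ℕ) : Submodule ℝ (Site d → Matrix n n ℂ) where
  carrier := {ξ | ξ ∈ periodicGaugeSpace (d := d) (n := n) P ∧ bmeanIterW L k W ξ = 0}
  zero_mem' := ⟨(periodicGaugeSpace (d := d) (n := n) P).zero_mem, bmeanIterW_zero' L k W⟩
  add_mem' := by
    rintro ξ ζ ⟨hξ, hξ0⟩ ⟨hζ, hζ0⟩
    exact ⟨(periodicGaugeSpace (d := d) (n := n) P).add_mem hξ hζ, by rw [bmeanIterW_add, hξ0, hζ0, add_zero]⟩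
  smul_mem' := by
    rintro t ξ ⟨hξ, hξ0⟩
    exact ⟨(periodicGaugeSpace (d := d) (n := n) P).smul_mem t hξ, by rw [bmeanIterW_smul, hξ0, smul_zero]⟩

/-- Membership in `Ξ_Q(W)`, unfolded. [folklore] -/
theorem mem_meanZeroGaugeSpaceW_iff {L k P : ℕ} {W : Site d → Fin d → (Matrix n n ℂ)ˣ} {ξ : Site d → Matrix n n ℂ} :
    ξ ∈ meanZeroGaugeSpaceW (d := d) (n := n) L k W P ↔
      ((∀ (x : Site d) (κ : Fin d), ξ (x + (P : ℤ) • e κ) = ξ x) ∧ ∀ x : Site d, ξ x ∈ skewAdjoint (Matrix n n ℂ)) ∧ bmeanIterW L k W ξ = 0 :=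
  Iff.rfl

/-- `Ξ_Q(W) ≤ periodicGaugeSpace`. [folklore] -/
theorem meanZeroGaugeSpaceW_le (L k : ℕ) (W : Site d → Fin d → (Matrix n n ℂ)ˣ) (P : ℕ) :
    meanZeroGaugeSpaceW (d := d) (n := n) L k W P ≤ periodicGaugeSpace (d := d) (n := n) P := fun _ h => h.1

/-! ## §2 Zero propagation without corner pinning -/

/-- **A COVARIANTLY CONSTANT GENERATOR WITH VANISHING NESTED BLOCK MEAN VANISHES.**  Multi-level small-field class at a unitary `W` of period `tower L N (j+1)`: if
`gaugeDir W ξ = 0` and `bmeanIterW L (j+1) W ξ = 0` for a skew `(L^{j+1}N)`-periodic `ξ`, then `ξ = 0`.  [The curved (‡) `framePotW_gaugeDir` at `gaugeDir W ξ = 0` gives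
`ξ (M•z) = bmeanIterW … ξ z = 0` at every top corner; then row NE3's walk `eq_zero_of_gaugeDir_eq_zero`.] [folklore] -/
theorem eq_zero_of_gaugeDir_eq_zero_of_bmeanIterW [Nonempty n] {L N : ℕ} [NeZero N] (hL : 1 ≤ L) (j : ℕ)
    {W : Site d → Fin d → (Matrix n n ℂ)ˣ} {x : ℝ}
    (hWu : IsUnitaryCfg W) (hWP : IsPeriodicCfg W ((tower L N (j + 1) : ℕ) : ℤ)) (hx : 0 ≤ x) (hs : LevelSmall d L j x) (hWx : SmallField W x)
    {ξ : Site d → Matrix n n ℂ} (hξs : ∀ y, ξ y ∈ skewAdjoint (Matrix n n ℂ))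
    (hξP : ∀ (y : Site d) (i : Fin d), ξ (y + ((tower L N (j + 1) : ℕ) : ℤ) • e i) = ξ y)
    (hg : ∀ (y : Site d) (μ : Fin d), gaugeDir W ξ y μ = 0) (hm : bmeanIterW L (j + 1) W ξ = 0) : ξ = 0 := by
  have hM : 1 ≤ L ^ (j + 1) := Nat.one_le_pow _ L (by omega)
  have hg0 : gaugeDir W ξ = fun (_ : Site d) (_ : Fin d) => (0 : Matrix n n ℂ) := by funext y μ; exact hg y μ
  have hcorner : ∀ w : Site d, ξ (((L ^ (j + 1) : ℕ) : ℤ) • w) = 0 := by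
    intro w
    have h1 := framePotW_gaugeDir (M := N) hL j hWu hWP hx hs hWx hξs hξP w
    rw [hg0, framePotW_zero_dir hL j hWu hx hs hWx, hm] at h1
    have h2 : ξ (((L : ℤ) ^ (j + 1)) • w) = 0 := by
      have := h1; simp only [Pi.zero_apply, sub_zero] at this; exact this.symm
    have e1 : (((L ^ (j + 1) : ℕ) : ℤ) • w : Site d) = ((L : ℤ) ^ (j + 1)) • w := by push_cast; rfl
    rw [e1]; exact h2
  exact eq_zero_of_gaugeDir_eq_zero hM hg hcorner

/-! ## §3 The Gram form of `gaugeDir W` on `Ξ_Q(W)`; the projection step with corners free -/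

/-- THE GRAM FORM OF `D_W` ON `Ξ_Q(W)` over the period box. [folklore] -/
def gramQ (L k : ℕ) (W : Site d → Fin d → (Matrix n n ℂ)ˣ) (P : ℕ) : LinearMap.BilinForm ℝ (meanZeroGaugeSpaceW (d := d) (n := n) L k W P) :=
  LinearMap.mk₂ ℝ
    (fun η ζ => ∑ x ∈ periodBox (d := d) P, ∑ μ : Fin d,
      hsR (gaugeDir W (η : Site d → Matrix n n ℂ) x μ) (gaugeDir W (ζ : Site d → Matrix n n ℂ) x μ))
    (fun η η' ζ => by
      simp only [Submodule.coe_add, gaugeDir_add_pi, hsR_add_left, Finset.sum_add_distrib])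
    (fun t η ζ => by
      simp only [Submodule.coe_smul, gaugeDir_smul_pi, hsR_smul_left, Finset.mul_sum, smul_eq_mul])
    (fun η ζ ζ' => by
      simp only [Submodule.coe_add, gaugeDir_add_pi, hsR_add_right, Finset.sum_add_distrib])
    (fun t η ζ => by
      simp only [Submodule.coe_smul, gaugeDir_smul_pi, hsR_smul_right, Finset.mul_sum, smul_eq_mul])

/-- `gramQ` unfolded. [folklore] -/
theorem gramQ_apply (L k : ℕ) (W : Site d → Fin d → (Matrix n n ℂ)ˣ) (P : ℕ) (η ζ : meanZeroGaugeSpaceW (d := d) (n := n) L k W P) :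
    gramQ L k W P η ζ = ∑ x ∈ periodBox (d := d) P, ∑ μ : Fin d,
      hsR (gaugeDir W (η : Site d → Matrix n n ℂ) x μ) (gaugeDir W (ζ : Site d → Matrix n n ℂ) x μ) :=
  rfl

/-- **THE GRAM FORM OF `D_W` IS NONDEGENERATE ON `Ξ_Q(W)`** (multi-level small-field class, `W` of period `P = tower L N (j+1)`): a null vector has `gaugeDir W η = 0` on the
period box, hence everywhere, hence `η = 0` by §2. [folklore] -/
theorem gramQ_nondegenerate [Nonempty n] {L N : ℕ} [NeZero N] (hL : 1 ≤ L) (j : ℕ)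
    {W : Site d → Fin d → (Matrix n n ℂ)ˣ} {x : ℝ}
    (hWu : IsUnitaryCfg W) (hWP : IsPeriodicCfg W ((tower L N (j + 1) : ℕ) : ℤ)) (hx : 0 ≤ x) (hs : LevelSmall d L j x) (hWx : SmallField W x) :
    (gramQ (d := d) (n := n) L (j + 1) W (tower L N (j + 1))).Nondegenerate := by
  have hP : 1 ≤ tower L N (j + 1) := by
    have h := natCast_tower_eq_pow_mul L N (j + 1)
    have h' : tower L N (j + 1) = L ^ (j + 1) * N := by exact_mod_cast h
    rw [h']; exact Nat.one_le_iff_ne_zero.mpr (Nat.mul_ne_zero (pow_ne_zero _ (by omega)) (NeZero.ne N))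
  have key : ∀ η : meanZeroGaugeSpaceW (d := d) (n := n) L (j + 1) W (tower L N (j + 1)), gramQ L (j + 1) W _ η η = 0 → η = 0 := by
    intro η h
    rw [gramQ_apply] at h
    simp only [hsR_self] at h
    obtain ⟨⟨hηP, hηs⟩, hη0⟩ := mem_meanZeroGaugeSpaceW_iff.mp η.2
    have hbox : ∀ y ∈ periodBox (d := d) (tower L N (j + 1)), ∀ μ : Fin d, gaugeDir W (η : Site d → Matrix n n ℂ) y μ = 0 := by
      intro y hy μ
      have h1 := (Finset.sum_eq_zero_iff_of_nonneg fun y _ =>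
        Finset.sum_nonneg fun ν _ => nhsNormSq_nonneg (gaugeDir W (η : Site d → Matrix n n ℂ) y ν)).1 h y hy
      have h2 := (Finset.sum_eq_zero_iff_of_nonneg fun ν _ =>
        nhsNormSq_nonneg (gaugeDir W (η : Site d → Matrix n n ℂ) y ν)).1 h1 μ (Finset.mem_univ μ)
      exact eq_zero_of_nhsNormSq_eq_zero h2
    have hper := isPeriodicDir_gaugeDir hWP hηP
    have hall : ∀ (y : Site d) (μ : Fin d), gaugeDir W (η : Site d → Matrix n n ℂ) y μ = 0 := by
      intro y μ
      have hw := apply_wrap_eq (g := fun y => gaugeDir W (η : Site d → Matrix n n ℂ) y μ) (fun y κ => hper y κ μ) y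
      rw [← hw]
      exact hbox _ (wrap_mem_periodBox _ hP y) μ
    exact Subtype.ext (eq_zero_of_gaugeDir_eq_zero_of_bmeanIterW hL j hWu hWP hx hs hWx hηs hηP hall hη0)
  exact ⟨fun η hη => key η (hη η), fun η hη => key η (hη η)⟩

/-- **THE PROJECTION STEP WITH CORNERS FREE**: in the class, for every direction field `Y` there is `η ∈ Ξ_Q(W)` with `Y + gaugeDir W η` `hsR`-orthogonal over the period box
`periodBox (tower L N (j+1))` to `gaugeDir W ζ` for every `ζ ∈ Ξ_Q(W)` (Riesz vector for the nondegenerate `gramQ`). [folklore] -/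
theorem exists_orthogonalQ [Nonempty n] {L N : ℕ} [NeZero N] (hL : 1 ≤ L) (j : ℕ)
    {W : Site d → Fin d → (Matrix n n ℂ)ˣ} {x : ℝ}
    (hWu : IsUnitaryCfg W) (hWP : IsPeriodicCfg W ((tower L N (j + 1) : ℕ) : ℤ)) (hx : 0 ≤ x) (hs : LevelSmall d L j x) (hWx : SmallField W x)
    (Y : Site d → Fin d → Matrix n n ℂ) :
    ∃ η ∈ meanZeroGaugeSpaceW (d := d) (n := n) L (j + 1) W (tower L N (j + 1)),
      ∀ ζ ∈ meanZeroGaugeSpaceW (d := d) (n := n) L (j + 1) W (tower L N (j + 1)),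
        ∑ y ∈ periodBox (d := d) (tower L N (j + 1)), ∑ μ : Fin d, hsR (Y y μ + gaugeDir W η y μ) (gaugeDir W ζ y μ) = 0 := by
  have hP : 1 ≤ tower L N (j + 1) := by
    have h := natCast_tower_eq_pow_mul L N (j + 1)
    have h' : tower L N (j + 1) = L ^ (j + 1) * N := by exact_mod_cast h
    rw [h']; exact Nat.one_le_iff_ne_zero.mpr (Nat.mul_ne_zero (pow_ne_zero _ (by omega)) (NeZero.ne N))
  haveI := finiteDimensional_periodicGaugeSpace (d := d) (n := n) hP
  haveI : FiniteDimensional ℝ (meanZeroGaugeSpaceW (d := d) (n := n) L (j + 1) W (tower L N (j + 1))) :=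
    Submodule.finiteDimensional_of_le (meanZeroGaugeSpaceW_le (d := d) (n := n) L (j + 1) W (tower L N (j + 1)))
  let ℓ : Module.Dual ℝ (meanZeroGaugeSpaceW (d := d) (n := n) L (j + 1) W (tower L N (j + 1))) :=
    { toFun := fun ζ => -∑ y ∈ periodBox (d := d) (tower L N (j + 1)), ∑ μ : Fin d, hsR (Y y μ) (gaugeDir W (ζ : Site d → Matrix n n ℂ) y μ)
      map_add' := fun ζ ζ' => by
        simp only [Submodule.coe_add, gaugeDir_add_pi, hsR_add_right, Finset.sum_add_distrib, neg_add]
      map_smul' := fun t ζ => by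
        simp only [Submodule.coe_smul, gaugeDir_smul_pi, hsR_smul_right, Finset.mul_sum, RingHom.id_apply, smul_eq_mul,
          mul_neg] }
  have hnd := gramQ_nondegenerate (d := d) (n := n) hL j hWu hWP hx hs hWx
  set η := ((gramQ (d := d) (n := n) L (j + 1) W (tower L N (j + 1))).toDual hnd).symm ℓ with hη_def
  refine ⟨η, η.2, fun ζ hζ => ?_⟩
  have h := LinearMap.BilinForm.apply_toDual_symm_apply (hB := hnd) ℓ ⟨ζ, hζ⟩
  rw [← hη_def, gramQ_apply] at h
  have hℓ : ℓ ⟨ζ, hζ⟩ = -∑ y ∈ periodBox (d := d) (tower L N (j + 1)), ∑ μ : Fin d, hsR (Y y μ) (gaugeDir W ζ y μ) := rfl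
  rw [hℓ] at h
  simp only [hsR_add_left, Finset.sum_add_distrib]
  linarith

/-! ## §4 The energy block-Landau slice `𝒯_E(W)` -/

/-- **THE ENERGY BLOCK-LANDAU SLICE `𝒯_E(W)`** (`energyBlockLandauW L N k W`; memo ROAD-G99 §3.1∕§3.6): skew, `(tower L N k)`-periodic directions in the DOUBLE-BAR KERNEL
(`QbarIter L k W X = 0` — Bałaban's constraint space `N(Q̄_k)`) that are `hsR`-ORTHOGONAL over the period box to `gaugeDir W ζ` for every `ζ ∈ Ξ_Q(W)` (⟺ the covariant divergence is a
transported block constant at EVERY site — corners included; no frame condition, no corner pinning). [folklore] -/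
def energyBlockLandauW (L N k : ℕ) (W : Site d → Fin d → (Matrix n n ℂ)ˣ) : Set (Site d → Fin d → Matrix n n ℂ) :=
  {X | IsSkewDir X ∧ IsPeriodicDir X ((tower L N k : ℕ) : ℤ) ∧ QbarIter L k W X = 0
      ∧ ∀ ζ ∈ meanZeroGaugeSpaceW (d := d) (n := n) L k W (tower L N k),
          ∑ y ∈ periodBox (d := d) (tower L N k), ∑ κ : Fin d, hsR (X y κ) (gaugeDir W ζ y κ) = 0}

/-- **PYTHAGORAS ON `𝒯_E(W)`**: for `X ∈ 𝒯_E(W)` and `ζ ∈ Ξ_Q(W)`, `Σ nhsNormSq (X + gaugeDir W ζ) = Σ nhsNormSq X + Σ nhsNormSq (gaugeDir W ζ)` over the period box; hence the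
min-norm property `Σ nhsNormSq X ≤ Σ nhsNormSq (X + gaugeDir W ζ)`. [folklore] -/
theorem sum_nhsNormSq_add_gaugeDir_eq_of_mem {L N k : ℕ} {W : Site d → Fin d → (Matrix n n ℂ)ˣ}
    {X : Site d → Fin d → Matrix n n ℂ} (hX : X ∈ energyBlockLandauW (d := d) (n := n) L N k W)
    {ζ : Site d → Matrix n n ℂ} (hζ : ζ ∈ meanZeroGaugeSpaceW (d := d) (n := n) L k W (tower L N k)) :
    ∑ y ∈ periodBox (d := d) (tower L N k), ∑ κ : Fin d, nhsNormSq (X y κ + gaugeDir W ζ y κ)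
      = ∑ y ∈ periodBox (d := d) (tower L N k), ∑ κ : Fin d, nhsNormSq (X y κ)
        + ∑ y ∈ periodBox (d := d) (tower L N k), ∑ κ : Fin d, nhsNormSq (gaugeDir W ζ y κ) := by
  have horth := hX.2.2.2 ζ hζ
  simp_rw [nhsNormSq_add, Finset.sum_add_distrib, ← Finset.mul_sum]
  rw [horth, mul_zero, add_zero]

/-- **MIN-NORM**: `Σ nhsNormSq X ≤ Σ nhsNormSq (X + gaugeDir W ζ)` on `𝒯_E(W)` against `Ξ_Q(W)`. [folklore] -/
theorem sum_nhsNormSq_le_of_mem {L N k : ℕ} {W : Site d → Fin d → (Matrix n n ℂ)ˣ}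
    {X : Site d → Fin d → Matrix n n ℂ} (hX : X ∈ energyBlockLandauW (d := d) (n := n) L N k W)
    {ζ : Site d → Matrix n n ℂ} (hζ : ζ ∈ meanZeroGaugeSpaceW (d := d) (n := n) L k W (tower L N k)) :
    ∑ y ∈ periodBox (d := d) (tower L N k), ∑ κ : Fin d, nhsNormSq (X y κ)
      ≤ ∑ y ∈ periodBox (d := d) (tower L N k), ∑ κ : Fin d, nhsNormSq (X y κ + gaugeDir W ζ y κ) := by
  rw [sum_nhsNormSq_add_gaugeDir_eq_of_mem hX hζ]
  have h0 : 0 ≤ ∑ y ∈ periodBox (d := d) (tower L N k), ∑ κ : Fin d, nhsNormSq (gaugeDir W ζ y κ) :=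
    Finset.sum_nonneg fun y _ => Finset.sum_nonneg fun κ _ => nhsNormSq_nonneg _
  linarith

/-- **(E_Q) THE DECOMPOSITION OF THE DOUBLE-BAR KERNEL**: in the class, every skew `(L^{j+1}N)`-periodic `Y` with `QbarIter L (j+1) W Y = 0` is `Y = Y_E − gaugeDir W η` with
`Y_E ∈ 𝒯_E(W)` and `η ∈ Ξ_Q(W)` — i.e. `Y + gaugeDir W η ∈ 𝒯_E(W)` for the Riesz `η` of §3 (the double-bar kernel is stable under `gaugeDir W (Ξ_Q)`:
`QbarIter (gaugeDir W η) = gaugeDir (cavgIter W) (bmeanIterW η) = 0`). [folklore] -/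
theorem exists_decomposition_of_QbarIter_eq_zero [Nonempty n] {L N : ℕ} [NeZero N] (hL : 1 ≤ L) (j : ℕ)
    {W : Site d → Fin d → (Matrix n n ℂ)ˣ} {x : ℝ}
    (hWu : IsUnitaryCfg W) (hWP : IsPeriodicCfg W ((tower L N (j + 1) : ℕ) : ℤ)) (hx : 0 ≤ x) (hs : LevelSmall d L j x) (hWx : SmallField W x)
    {Y : Site d → Fin d → Matrix n n ℂ} (hY : IsSkewDir Y) (hYP : IsPeriodicDir Y ((tower L N (j + 1) : ℕ) : ℤ))
    (hQ : QbarIter L (j + 1) W Y = 0) :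
    ∃ η ∈ meanZeroGaugeSpaceW (d := d) (n := n) L (j + 1) W (tower L N (j + 1)),
      (fun y κ => Y y κ + gaugeDir W η y κ) ∈ energyBlockLandauW (d := d) (n := n) L N (j + 1) W := by
  obtain ⟨η, hη, horth⟩ := exists_orthogonalQ hL j hWu hWP hx hs hWx Y
  obtain ⟨⟨hηP, hηs⟩, hη0⟩ := mem_meanZeroGaugeSpaceW_iff.mp hη
  refine ⟨η, hη, ?_, ?_, ?_, ?_⟩
  · exact fun y κ => (skewAdjoint _).add_mem (hY y κ) (gaugeDir_skew hWu hηs y κ)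
  · intro y i κ
    have h1 := hYP y i κ
    have h2 := isPeriodicDir_gaugeDir hWP hηP y i κ
    simp only
    rw [h1, h2]
  · -- the double-bar kernel is stable under mean-zero gauge directions
    have hQη : QbarIter L (j + 1) W (gaugeDir W η) = 0 := by
      rw [QbarIter_gaugeDir_eq_bmean hL j hWu hWP hx hs hWx hηs hηP, hη0]
      funext z κ
      simp [gaugeDir, T4AveragingDeficitWall.Ad]
    have hadd := QbarIter_add hL j hWu hx hs hWx Y (gaugeDir W η)
    rw [hadd, hQ, hQη]
    funext z κ; simp
  · exact horth

/-- **TRANSVERSALITY**: `𝒯_E(W) ∩ gaugeDir W (Ξ_Q(W)) = {0}` on the period box — if `X ∈ 𝒯_E(W)` equals `gaugeDir W ξ` with `ξ ∈ Ξ_Q(W)`, then `X` vanishes on the period box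
(Pythagoras with `ζ = −ξ`); in the class this gives `ξ = 0` by §2. [folklore] -/
theorem sum_nhsNormSq_eq_zero_of_mem_of_eq_gaugeDir {L N k : ℕ} {W : Site d → Fin d → (Matrix n n ℂ)ˣ}
    {X : Site d → Fin d → Matrix n n ℂ} (hX : X ∈ energyBlockLandauW (d := d) (n := n) L N k W)
    {ξ : Site d → Matrix n n ℂ} (hξ : ξ ∈ meanZeroGaugeSpaceW (d := d) (n := n) L k W (tower L N k))
    (hXξ : ∀ y κ, X y κ = gaugeDir W ξ y κ) :
    ∑ y ∈ periodBox (d := d) (tower L N k), ∑ κ : Fin d, nhsNormSq (X y κ) = 0 := by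
  have horth := hX.2.2.2 ξ hξ
  have h1 : ∑ y ∈ periodBox (d := d) (tower L N k), ∑ κ : Fin d, hsR (X y κ) (gaugeDir W ξ y κ)
      = ∑ y ∈ periodBox (d := d) (tower L N k), ∑ κ : Fin d, nhsNormSq (X y κ) := by
    refine Finset.sum_congr rfl fun y _ => Finset.sum_congr rfl fun κ _ => ?_
    rw [← hXξ y κ, hsR_self]
  rw [← h1, horth]

/-- **CRITICALITY ALONG `𝒯_E(W)`**: a background that is tangent-critical on a window `F` (the ENDs' `hcrit`) is critical along every element of `𝒯_E(W)` — gen 99's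
`NE7QbarTangentCritical.dAction_eq_zero_of_QbarIter_eq_zero` (only `QbarIter = 0` is used). [folklore] -/
theorem dAction_eq_zero_of_mem [Nonempty n] {L N : ℕ} [NeZero N] (hL : 1 ≤ L) (j : ℕ)
    {W : Site d → Fin d → (Matrix n n ℂ)ˣ} {x : ℝ}
    (hWu : IsUnitaryCfg W) (hWP : IsPeriodicCfg W ((tower L N (j + 1) : ℕ) : ℤ)) (hx : 0 ≤ x) (hs : LevelSmall d L j x) (hWx : SmallField W x)
    (F : Finset (Plaq d))
    (hcrit : ∀ φ : Site d → Fin d → Matrix n n ℂ, IsSkewDir φ → IsPeriodicDir φ ((tower L N (j + 1) : ℕ) : ℤ) →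
      TangentIter L j W φ → dAction W φ F = 0)
    {X : Site d → Fin d → Matrix n n ℂ} (hX : X ∈ energyBlockLandauW (d := d) (n := n) L N (j + 1) W) :
    dAction W X F = 0 :=
  dAction_eq_zero_of_QbarIter_eq_zero hL j hWu hWP hx hs hWx F hcrit hX.1 hX.2.1 hX.2.2.1

end

end Summit.QuantumFields.BalabanUV.T4Continuum.NE7MeanZeroGaugeSliceW
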